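import Literature.NumberTheory.Irrationality.Fischler2002.Theoreme32PermProofs
import HarnessLib

/-!
# Fischler 2002, Théorème 3.2 — brick II: for `n = 2` the group `⟨σ, ψ, φ⟩` has order `120` (a faithful `𝔖₅`)

Topic `Literature/NumberTheory/Irrationality/Fischler2002`. PROOFS ONLY (no definition, no statement, no discharge): second brick
toward the named fact `theoreme32` of `RhinViolaGroupsGeneral.lean` —

> [Fischler2002Polyzetas, §3 Théorème 3.2] « Pour `n = 2`, le groupe `G` est isomorphe à `𝔖₅`, et laisse stable
> `𝒥(p)/(a₁! a₂! b₁! b₂! (a₁+b₂−c₂)!)` » (`paper:arxiv-math_0202064` p. 4; [Fischler2003RhinViola, §3.4 Th. 6: « donc d'ordre 120 »]).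

For `n = 2` (where `𝓔 = ℤ⁵`, the relations of `InE 2` being void) we prove `Nat.card ⟨σ', ψ', φ'⟩ = 120 = rvGroupOrder 2` for ANY
permutations `σ', ψ', φ'` of `{p // InE 2 p}` with underlying maps `sigma`, `psi 2`, `phi 2` (`card_closure_eq_two`). ROUTE (the
Rhin–Viola `ζ(2)` picture, found by the seat's reconnaissance `HOME/ct-1/g33/THEOREME32-RECON.md`): the group PERMUTES the ten
linear forms `c₂, b₂, b₁, a₁−a₂+b₁, a₂−b₁+b₂, a₂, a₁, a₂+b₂−c₂, a₁+b₂−c₂, a₁+b₁−c₂`, which are naturally indexed by the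
2-subsets `{s,t}` of a 5-set so that `σ, ψ, φ` act through `(0 1)(2 4)`, `(0 2)(3 4)`, `(0 4) ∈ 𝔖₅`; the induced map
`ρ : ⟨σ',ψ',φ'⟩ → Perm (Fin 5)` is a well-defined INJECTIVE homomorphism (the five coordinates are among the ten forms, the other
coordinates are inert) whose image contains a 5-cycle (`ψσ`) and a transposition (`φ`), hence is everything
(`Equiv.Perm.closure_prime_cycle_swap`). The forms are carried by a FREE function symbol `ℓ` with its defining table (no
definition is introduced). Cell `pub-zeta5`, seat ct-1 g33, 2026-08-27.

HONEST FRAMING (cell pub-zeta5): systematic search; no irrationality claim unless certified — pure bookkeeping of a printed group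
structure; nothing about `ζ(5)`.
-/

namespace Literature.NumberTheory.Irrationality.Fischler2002

namespace Theoreme32

open Equiv

section OrderTwo

variable {ℓ : Fin 5 → Fin 5 → Exponents → ℤ}
  (hℓ : ∀ (s t : Fin 5) (p : Exponents), ℓ s t p =
    if min s.val t.val * 5 + max s.val t.val = 1 then p.c 2
    else if min s.val t.val * 5 + max s.val t.val = 2 then p.b 2
    else if min s.val t.val * 5 + max s.val t.val = 3 then p.b 1
    else if min s.val t.val * 5 + max s.val t.val = 4 then p.a 1 - p.a 2 + p.b 1
    else if min s.val t.val * 5 + max s.val t.val = 7 then p.a 2 - p.b 1 + p.b 2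
    else if min s.val t.val * 5 + max s.val t.val = 8 then p.a 2
    else if min s.val t.val * 5 + max s.val t.val = 9 then p.a 1
    else if min s.val t.val * 5 + max s.val t.val = 13 then p.a 2 + p.b 2 - p.c 2
    else if min s.val t.val * 5 + max s.val t.val = 14 then p.a 1 + p.b 2 - p.c 2
    else if min s.val t.val * 5 + max s.val t.val = 19 then p.a 1 + p.b 1 - p.c 2 else 0)
  {gσ gψ gφ : Perm {p : Exponents // InE 2 p}}

/-! ### The ten forms and the action of the generators -/

include hℓ in
/-- The table is symmetric: `ℓ s t = ℓ t s`. [cite: Fischler2002Polyzetas, §3 Théorème 3.2 (n = 2)] -/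
theorem form_symm (s t : Fin 5) (p : Exponents) : ℓ s t p = ℓ t s p := by
  rw [hℓ, hℓ, min_comm, max_comm]

include hℓ in
/-- `σ` acts on the forms through `(0 1)(2 4) ∈ 𝔖₅`. [cite: Fischler2002Polyzetas, §3 Théorème 3.2 (n = 2)] -/
theorem rel_sigma (hσ : ∀ p, (gσ p).1 = sigma p.1) (s t : Fin 5) (hst : s ≠ t) (p : {p : Exponents // InE 2 p}) :
    ℓ s t (gσ p).1 = ℓ ((swap (0 : Fin 5) 1 * swap (2 : Fin 5) 4) s) ((swap (0 : Fin 5) 1 * swap (2 : Fin 5) 4) t) p.1 := by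
  rw [hσ p]
  fin_cases s <;> fin_cases t <;> first | exact absurd rfl hst | (simp [hℓ, sigma, Equiv.swap_apply_def]; try ring)


include hℓ in
/-- `ψ` acts on the forms through `(0 2)(3 4) ∈ 𝔖₅`. [cite: Fischler2002Polyzetas, §3 Théorème 3.2 (n = 2)] -/
theorem rel_psi (hψ : ∀ p, (gψ p).1 = psi 2 p.1) (s t : Fin 5) (hst : s ≠ t) (p : {p : Exponents // InE 2 p}) :
    ℓ s t (gψ p).1 = ℓ ((swap (0 : Fin 5) 2 * swap (3 : Fin 5) 4) s) ((swap (0 : Fin 5) 2 * swap (3 : Fin 5) 4) t) p.1 := by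
  rw [hψ p]
  fin_cases s <;> fin_cases t <;> first | exact absurd rfl hst | (simp [hℓ, psi, Equiv.swap_apply_def]; try ring)

include hℓ in
/-- `φ` acts on the forms through the transposition `(0 4) ∈ 𝔖₅`. [cite: Fischler2002Polyzetas, §3 Théorème 3.2 (n = 2)] -/
theorem rel_phi (hφ : ∀ p, (gφ p).1 = phi 2 p.1) (s t : Fin 5) (hst : s ≠ t) (p : {p : Exponents // InE 2 p}) :
    ℓ s t (gφ p).1 = ℓ ((swap (0 : Fin 5) 4) s) ((swap (0 : Fin 5) 4) t) p.1 := by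
  rw [hφ p]
  fin_cases s <;> fin_cases t <;> first | exact absurd rfl hst | (simp [hℓ, phi, Equiv.swap_apply_def]; try ring)

/-! ### The relation «`g` acts on the forms through `π`» is multiplicative -/

/-- Products: if `g` acts through `π` and `h` through `τ` then `gh` acts through `τπ` (an anti-homomorphism).
[cite: Fischler2002Polyzetas, §3 Théorème 3.2 (n = 2)] -/
theorem rel_mul {g h : Perm {p : Exponents // InE 2 p}} {π τ : Perm (Fin 5)}
    (hg : ∀ s t : Fin 5, s ≠ t → ∀ p, ℓ s t (g p).1 = ℓ (π s) (π t) p.1)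
    (hh : ∀ s t : Fin 5, s ≠ t → ∀ p, ℓ s t (h p).1 = ℓ (τ s) (τ t) p.1) :
    ∀ s t : Fin 5, s ≠ t → ∀ p, ℓ s t ((g * h) p).1 = ℓ ((τ * π) s) ((τ * π) t) p.1 := by
  intro s t hst p
  rw [Perm.mul_apply, hg s t hst, hh (π s) (π t) (fun e => hst (π.injective e)), Perm.mul_apply, Perm.mul_apply]

/-- Inverses: if `g` acts through `π` then `g⁻¹` acts through `π⁻¹`. [cite: Fischler2002Polyzetas, §3 Théorème 3.2 (n = 2)] -/
theorem rel_inv {g : Perm {p : Exponents // InE 2 p}} {π : Perm (Fin 5)}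
    (hg : ∀ s t : Fin 5, s ≠ t → ∀ p, ℓ s t (g p).1 = ℓ (π s) (π t) p.1) :
    ∀ s t : Fin 5, s ≠ t → ∀ p, ℓ s t (g⁻¹ p).1 = ℓ (π⁻¹ s) (π⁻¹ t) p.1 := by
  intro s t hst p
  have h := hg (π⁻¹ s) (π⁻¹ t) (fun e => hst (π⁻¹.injective e)) (g⁻¹ p)
  simp only [Perm.coe_inv, Equiv.apply_symm_apply] at h ⊢
  exact h.symm

include hℓ in
/-- **Every element of `⟨σ', ψ', φ'⟩` acts on the ten forms through some `π ∈ 𝔖₅`.**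
[cite: Fischler2002Polyzetas, §3 Théorème 3.2 (n = 2)] -/
theorem exists_rel_of_mem (hσ : ∀ p, (gσ p).1 = sigma p.1) (hψ : ∀ p, (gψ p).1 = psi 2 p.1)
    (hφ : ∀ p, (gφ p).1 = phi 2 p.1) {g : Perm {p : Exponents // InE 2 p}}
    (hg : g ∈ Subgroup.closure ({gσ, gψ, gφ} : Set (Perm {p : Exponents // InE 2 p}))) :
    ∃ π : Perm (Fin 5), ∀ s t : Fin 5, s ≠ t → ∀ p, ℓ s t (g p).1 = ℓ (π s) (π t) p.1 := by
  induction hg using Subgroup.closure_induction with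
  | mem x hx =>
    simp only [Set.mem_insert_iff, Set.mem_singleton_iff] at hx
    rcases hx with rfl | rfl | rfl
    · exact ⟨_, rel_sigma hℓ hσ⟩
    · exact ⟨_, rel_psi hℓ hψ⟩
    · exact ⟨_, rel_phi hℓ hφ⟩
  | one => exact ⟨1, fun s t _ p => rfl⟩
  | mul x y _ _ ihx ihy =>
    obtain ⟨π, hπ⟩ := ihx
    obtain ⟨τ, hτ⟩ := ihy
    exact ⟨τ * π, rel_mul hπ hτ⟩
  | inv x _ ihx =>
    obtain ⟨π, hπ⟩ := ihx
    exact ⟨π⁻¹, rel_inv hπ⟩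

/-! ### The inert coordinates are fixed -/

/-- Every element of `⟨σ', ψ', φ'⟩` fixes the coordinates other than `a₁, a₂, b₁, b₂, c₂`.
[cite: Fischler2002Polyzetas, §3 Théorème 3.2 (n = 2)] -/
theorem inert_of_mem (hσ : ∀ p, (gσ p).1 = sigma p.1) (hψ : ∀ p, (gψ p).1 = psi 2 p.1)
    (hφ : ∀ p, (gφ p).1 = phi 2 p.1) {g : Perm {p : Exponents // InE 2 p}}
    (hg : g ∈ Subgroup.closure ({gσ, gψ, gφ} : Set (Perm {p : Exponents // InE 2 p}))) (p : {p : Exponents // InE 2 p}) :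
    (∀ k, k ≠ 1 → k ≠ 2 → (g p).1.a k = p.1.a k) ∧ (∀ k, k ≠ 1 → k ≠ 2 → (g p).1.b k = p.1.b k) ∧
      (∀ k, k ≠ 2 → (g p).1.c k = p.1.c k) := by
  induction hg using Subgroup.closure_induction generalizing p with
  | mem x hx =>
    simp only [Set.mem_insert_iff, Set.mem_singleton_iff] at hx
    rcases hx with rfl | rfl | rfl
    · rw [hσ p]
      refine ⟨fun k h1 h2 => ?_, fun k h1 h2 => ?_, fun k _ => rfl⟩ <;> simp [sigma, h1, h2]
    · rw [hψ p]
      refine ⟨fun k h1 h2 => ?_, fun k h1 h2 => ?_, fun k h2 => ?_⟩ <;> simp [psi] <;> omega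
    · rw [hφ p]
      refine ⟨fun k h1 _ => ?_, fun k h1 h2 => ?_, fun k h2 => ?_⟩
      · simp [phi, h1]
      · simp [phi, h1, h2]
      · simp [phi, h2]
  | one => exact ⟨fun k _ _ => rfl, fun k _ _ => rfl, fun k _ => rfl⟩
  | mul x y _ _ ihx ihy =>
    obtain ⟨ha, hb, hc⟩ := ihx (y p)
    obtain ⟨ha', hb', hc'⟩ := ihy p
    refine ⟨fun k h1 h2 => ?_, fun k h1 h2 => ?_, fun k h2 => ?_⟩
    · rw [Perm.mul_apply, ha k h1 h2, ha' k h1 h2]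
    · rw [Perm.mul_apply, hb k h1 h2, hb' k h1 h2]
    · rw [Perm.mul_apply, hc k h2, hc' k h2]
  | inv x _ ihx =>
    obtain ⟨ha, hb, hc⟩ := ihx (x⁻¹ p)
    simp only [Perm.coe_inv, Equiv.apply_symm_apply] at ha hb hc ⊢
    exact ⟨fun k h1 h2 => (ha k h1 h2).symm, fun k h1 h2 => (hb k h1 h2).symm, fun k h2 => (hc k h2).symm⟩

/-! ### Faithfulness: an element acting trivially on the forms is trivial -/

/-- Two exponent vectors with the same coordinates are equal. [cite: Fischler2002Polyzetas, §2 p. 2 (p ∈ ℤ^{3n−1})] -/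
theorem exponents_eq {p q : Exponents} (ha : ∀ k, p.a k = q.a k) (hb : ∀ k, p.b k = q.b k) (hc : ∀ k, p.c k = q.c k) :
    p = q := by
  cases p; cases q
  simp only [Exponents.mk.injEq]
  exact ⟨funext ha, funext hb, funext hc⟩

include hℓ in
/-- **Faithfulness.** An element of `⟨σ', ψ', φ'⟩` acting on the ten forms through the identity of `𝔖₅` is the identity: the five
coordinates `a₁ = ℓ₁₄, a₂ = ℓ₁₃, b₁ = ℓ₀₃, b₂ = ℓ₀₂, c₂ = ℓ₀₁` are among the forms and the other coordinates are inert.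
[cite: Fischler2002Polyzetas, §3 Théorème 3.2 (n = 2)] -/
theorem eq_one_of_rel_one (hσ : ∀ p, (gσ p).1 = sigma p.1) (hψ : ∀ p, (gψ p).1 = psi 2 p.1)
    (hφ : ∀ p, (gφ p).1 = phi 2 p.1) {g : Perm {p : Exponents // InE 2 p}}
    (hg : g ∈ Subgroup.closure ({gσ, gψ, gφ} : Set (Perm {p : Exponents // InE 2 p})))
    (h1 : ∀ s t : Fin 5, s ≠ t → ∀ p, ℓ s t (g p).1 = ℓ s t p.1) : g = 1 := by
  refine Equiv.ext fun p => Subtype.ext ?_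
  rw [Perm.one_apply]
  obtain ⟨ha, hb, hc⟩ := inert_of_mem hσ hψ hφ hg p
  have e14 := h1 1 4 (by decide) p
  have e13 := h1 1 3 (by decide) p
  have e03 := h1 0 3 (by decide) p
  have e02 := h1 0 2 (by decide) p
  have e01 := h1 0 1 (by decide) p
  simp [hℓ] at e14 e13 e03 e02 e01
  refine exponents_eq (fun k => ?_) (fun k => ?_) (fun k => ?_)
  · by_cases hk1 : k = 1
    · subst hk1; exact e14
    · by_cases hk2 : k = 2
      · subst hk2; exact e13
      · exact ha k hk1 hk2
  · by_cases hk1 : k = 1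
    · subst hk1; exact e03
    · by_cases hk2 : k = 2
      · subst hk2; exact e02
      · exact hb k hk1 hk2
  · by_cases hk2 : k = 2
    · subst hk2; exact e01
    · exact hc k hk2

/-! ### The permutation `π` is unique: the ten forms are pairwise distinct -/

include hℓ in
/-- **Uniqueness of `π`.** If `g` acts on the forms through `π` and through `π'` then `π = π'`: evaluating at the test point
`(a₁, a₂, b₁, b₂, c₂) = (1, 10, 100, 1000, 5000)`, where the ten forms take ten distinct values, the unordered pairs
`{π s, π t}` and `{π' s, π' t}` coincide for all `s ≠ t`, whence `π = π'` (three distinct indices suffice).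
[cite: Fischler2002Polyzetas, §3 Théorème 3.2 (n = 2)] -/
theorem rel_unique {g : Perm {p : Exponents // InE 2 p}} {π π' : Perm (Fin 5)}
    (hπ : ∀ s t : Fin 5, s ≠ t → ∀ p, ℓ s t (g p).1 = ℓ (π s) (π t) p.1)
    (hπ' : ∀ s t : Fin 5, s ≠ t → ∀ p, ℓ s t (g p).1 = ℓ (π' s) (π' t) p.1) : π = π' := by
  -- the test point and the values of the forms there
  let p₀ : {p : Exponents // InE 2 p} :=
    ⟨⟨fun k => if k = 1 then 1 else if k = 2 then 10 else 0, fun k => if k = 1 then 100 else if k = 2 then 1000 else 0,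
      fun k => if k = 2 then 5000 else 0⟩, fun k hk hk' => by omega, fun h => by omega, fun h => by omega⟩
  have hv : ∀ s t : Fin 5, ℓ s t p₀.1 =
      ![![(0 : ℤ), 5000, 1000, 100, 91], ![5000, 0, 910, 10, 1], ![1000, 910, 0, -3990, -3999],
        ![100, 10, -3990, 0, -4899], ![91, 1, -3999, -4899, 0]] s t := by
    intro s t
    fin_cases s <;> fin_cases t <;> simp [hℓ, p₀]
  have hinj : ∀ a b c d : Fin 5, a ≠ b →
      ![![(0 : ℤ), 5000, 1000, 100, 91], ![5000, 0, 910, 10, 1], ![1000, 910, 0, -3990, -3999],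
        ![100, 10, -3990, 0, -4899], ![91, 1, -3999, -4899, 0]] a b =
      ![![(0 : ℤ), 5000, 1000, 100, 91], ![5000, 0, 910, 10, 1], ![1000, 910, 0, -3990, -3999],
        ![100, 10, -3990, 0, -4899], ![91, 1, -3999, -4899, 0]] c d → (a = c ∧ b = d) ∨ (a = d ∧ b = c) := by
    decide
  -- the unordered pairs `{π s, π t} = {π' s, π' t}`
  have hpair : ∀ s t : Fin 5, s ≠ t → (π s = π' s ∧ π t = π' t) ∨ (π s = π' t ∧ π t = π' s) := by
    intro s t hst
    have e := (hπ s t hst p₀).symm.trans (hπ' s t hst p₀)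
    rw [hv, hv] at e
    exact hinj _ _ _ _ (fun h => hst (π.injective h)) e
  -- three distinct indices force `π s = π' s`
  ext s : 1
  obtain ⟨t₁, t₂, h1, h2, h12⟩ : ∃ t₁ t₂ : Fin 5, s ≠ t₁ ∧ s ≠ t₂ ∧ t₁ ≠ t₂ := by
    fin_cases s
    · exact ⟨1, 2, by decide, by decide, by decide⟩
    · exact ⟨0, 2, by decide, by decide, by decide⟩
    · exact ⟨0, 1, by decide, by decide, by decide⟩
    · exact ⟨0, 1, by decide, by decide, by decide⟩
    · exact ⟨0, 1, by decide, by decide, by decide⟩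
  rcases hpair s t₁ h1 with h | h
  · exact h.1
  · rcases hpair s t₂ h2 with h' | h'
    · exact h'.1
    · exact absurd (π'.injective (h.1.symm.trans h'.1)) h12

/-! ### The order `120` -/

include hℓ in
/-- **For `n = 2`, `|⟨σ', ψ', φ'⟩| = 120`** (for any permutations of `{p // p ∈ 𝓔}` with underlying maps `sigma`, `psi 2`,
`phi 2`): the action on the ten forms is a well-defined injective homomorphism `ρ` to `𝔖₅` (`exists_rel_of_mem`, `rel_unique`,
`eq_one_of_rel_one`) whose image contains the 5-cycle `ρ(σ'ψ') = (0 1 2 3 4)⁻¹` and the transposition `ρ(φ') = (0 4)`, hence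
is `𝔖₅` (`Equiv.Perm.closure_prime_cycle_swap`), of order `5! = 120`. [cite: Fischler2002Polyzetas, §3 Théorème 3.2 (n = 2)]
[cite: Fischler2003RhinViola, §3.4 Théorème 6 (n = 2 : 𝔖₅, ordre 120)] -/
theorem card_closure_eq_two_aux (hσ : ∀ p, (gσ p).1 = sigma p.1) (hψ : ∀ p, (gψ p).1 = psi 2 p.1)
    (hφ : ∀ p, (gφ p).1 = phi 2 p.1) :
    Nat.card (Subgroup.closure ({gσ, gψ, gφ} : Set (Perm {p : Exponents // InE 2 p}))) = 120 := by
  set G := Subgroup.closure ({gσ, gψ, gφ} : Set (Perm {p : Exponents // InE 2 p})) with hG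
  -- the permutation attached to each element
  have hex : ∀ g : G, ∃ π : Perm (Fin 5), ∀ s t : Fin 5, s ≠ t → ∀ p, ℓ s t (g.1 p).1 = ℓ (π s) (π t) p.1 :=
    fun g => exists_rel_of_mem hℓ hσ hψ hφ g.2
  choose πf hπf using hex
  -- the homomorphism `ρ g = (π_g)⁻¹`
  let ρ : G →* Perm (Fin 5) :=
    { toFun := fun g => (πf g)⁻¹
      map_one' := by
        have h1 : ∀ s t : Fin 5, s ≠ t → ∀ p, ℓ s t ((1 : G).1 p).1 = ℓ ((1 : Perm (Fin 5)) s) ((1 : Perm (Fin 5)) t) p.1 :=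
          fun s t _ p => rfl
        rw [rel_unique hℓ (hπf 1) h1, inv_one]
      map_mul' := fun g h => by
        have hm := rel_mul (hπf g) (hπf h)
        rw [← mul_inv_rev, ← rel_unique hℓ (hπf (g * h)) hm] }
  have hρ : ∀ g : G, ρ g = (πf g)⁻¹ := fun g => rfl
  -- injective
  have hinj : Function.Injective ρ := by
    refine (injective_iff_map_eq_one ρ).2 fun g hg => ?_
    rw [hρ, inv_eq_one] at hg
    have h1 : ∀ s t : Fin 5, s ≠ t → ∀ p, ℓ s t (g.1 p).1 = ℓ s t p.1 := by
      intro s t hst p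
      rw [hπf g s t hst p, hg, Perm.one_apply, Perm.one_apply]
    exact Subtype.ext (eq_one_of_rel_one hℓ hσ hψ hφ g.2 h1)
  -- surjective: a 5-cycle and a transposition in the image
  have hσmem : gσ ∈ G := Subgroup.subset_closure (by simp)
  have hψmem : gψ ∈ G := Subgroup.subset_closure (by simp)
  have hφmem : gφ ∈ G := Subgroup.subset_closure (by simp)
  have hc : ρ ⟨gσ * gψ, G.mul_mem hσmem hψmem⟩ = (finRotate 5)⁻¹ := by
    rw [hρ, inv_inj]
    have hm := rel_mul (rel_sigma hℓ hσ) (rel_psi hℓ hψ)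
    rw [rel_unique hℓ (hπf ⟨gσ * gψ, G.mul_mem hσmem hψmem⟩) hm]
    decide
  have ht : ρ ⟨gφ, hφmem⟩ = swap (0 : Fin 5) 4 := by
    rw [hρ, rel_unique hℓ (hπf ⟨gφ, hφmem⟩) (rel_phi hℓ hφ), swap_inv]
  have hsurj : Function.Surjective ρ := by
    rw [← MonoidHom.range_eq_top, eq_top_iff, ← Perm.closure_prime_cycle_swap (σ := (finRotate 5)⁻¹) (τ := swap (0 : Fin 5) 4)
      (by simp; decide) isCycle_finRotate.inv (by rw [Perm.support_inv]; exact support_finRotate) ⟨0, 4, by decide, rfl⟩]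
    refine (Subgroup.closure_le _).2 ?_
    rintro x hx
    simp only [Set.mem_insert_iff, Set.mem_singleton_iff] at hx
    rcases hx with rfl | rfl
    · exact ⟨_, hc⟩
    · exact ⟨_, ht⟩
  rw [Nat.card_congr (Equiv.ofBijective ρ ⟨hinj, hsurj⟩), Nat.card_perm, Nat.card_eq_fintype_card, Fintype.card_fin]
  rfl

end OrderTwo

/-- **Fischler's Théorème 3.2 for `n = 2`, the ORDER: `|⟨σ', ψ', φ'⟩| = 120 = rvGroupOrder 2`** for any permutations `σ', ψ', φ'` of
`{p // p ∈ 𝓔}` with underlying maps `sigma`, `psi 2`, `phi 2` (such permutations exist: `exists_perms`). The typed isomorphism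
type `𝔖₅` is realised by the action on the ten forms (`card_closure_eq_two_aux`).
[cite: Fischler2002Polyzetas, §3 Théorème 3.2 (n = 2)] [cite: Fischler2003RhinViola, §3.4 Théorème 6 p. 515] -/
theorem card_closure_eq_two {gσ gψ gφ : Perm {p : Exponents // InE 2 p}} (hσ : ∀ p, (gσ p).1 = sigma p.1)
    (hψ : ∀ p, (gψ p).1 = psi 2 p.1) (hφ : ∀ p, (gφ p).1 = phi 2 p.1) :
    Nat.card (Subgroup.closure ({gσ, gψ, gφ} : Set (Perm {p : Exponents // InE 2 p}))) = rvGroupOrder 2 := by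
  obtain ⟨ℓ, hℓ⟩ : ∃ ℓ : Fin 5 → Fin 5 → Exponents → ℤ, ∀ (s t : Fin 5) (p : Exponents), ℓ s t p =
      if min s.val t.val * 5 + max s.val t.val = 1 then p.c 2
      else if min s.val t.val * 5 + max s.val t.val = 2 then p.b 2
      else if min s.val t.val * 5 + max s.val t.val = 3 then p.b 1
      else if min s.val t.val * 5 + max s.val t.val = 4 then p.a 1 - p.a 2 + p.b 1
      else if min s.val t.val * 5 + max s.val t.val = 7 then p.a 2 - p.b 1 + p.b 2
      else if min s.val t.val * 5 + max s.val t.val = 8 then p.a 2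
      else if min s.val t.val * 5 + max s.val t.val = 9 then p.a 1
      else if min s.val t.val * 5 + max s.val t.val = 13 then p.a 2 + p.b 2 - p.c 2
      else if min s.val t.val * 5 + max s.val t.val = 14 then p.a 1 + p.b 2 - p.c 2
      else if min s.val t.val * 5 + max s.val t.val = 19 then p.a 1 + p.b 1 - p.c 2 else 0 := ⟨_, fun _ _ _ => rfl⟩
  rw [card_closure_eq_two_aux hℓ hσ hψ hφ, rvGroupOrder, if_pos rfl]


end Theoreme32

end Literature.NumberTheory.Irrationality.Fischler2002
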